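import Summits.Langlands.Langlands.Theses.ParityBlindBianchi
import Summits.Langlands.Langlands.Theorems.ParityBlindBianchiResidualBianchiDoorLevelQLevel
import Literature.NumberTheory.DiophantineGeometry.AVGaloisModule
import Literature.AlgebraicGeometry.Motives.AbelianVariety
import HarnessLib

/-!
# Sketch — crux idea `golden-surface-two-torsion` for stmt-Langlands-16853
`ParityBlindBianchi.ResidualBianchiDoorLevelBC` (E1″), round 1, ideator k = 1.

First-lemma signatures only (sorried where not definitional).  The line:

  SBTGoldenRealisation (K1)  +  GoldenPieceAutomorphic (K2)
      ⟹ QLevelPackage (C⁺, the K-free interface = conclusion of the landed `Sketch.stub_qLevel`)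
      ⟹ ResidualBianchiDoorLevelBC (transfer = re-plumbing of p125055 over QuadraticBaseChangeGL2).

Engine #1 of C⁺ is the landed KW line (`qLevelPackage_of_khareWintenberger`, proved below by
`exact`); engine #2 (this card) is Shepherd-Barron–Taylor's golden-surface realisation + modularity
of √5-RM surfaces at the prime √5 (X(5)-twist + BCDT + Kisin, p = 5 odd), no Serre conjecture and no
2-adic lifting anywhere.
-/

noncomputable section

namespace Summit.Langlands.Langlands.Cruxes.ResidualBianchiDoorLevelBC.GoldenSurfaceTwoTorsion

set_option linter.dupNamespace false

open scoped MatrixGroups Polynomial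
open Polynomial NumberField IsDedekindDomain CategoryTheory
open Literature.NumberTheory.Automorphic Literature.NumberTheory.GaloisRepresentations
open Literature.AlgebraicGeometry.Motives

/-- **C⁺ — the K-free interface.**  Weight-two-type residual modularity over `ℚ` of every
irreducible icosahedral Artin `ρ`, at a finite bad set of PRIMES `S ∋ 2`: verbatim the conclusion
of the landed `ResidualBianchiDoorLevel.Sketch.stub_qLevel` with its Khare–Wintenberger hypothesis
removed.  Both engines (KW; golden surfaces) target exactly this statement. -/
def QLevelPackage : Prop :=
  ∀ (ι : PadicAlgCl 2 ≃+* ℂ) (ρ : FramedGaloisRep ℚ ℂ 2), ρ.toGaloisRep.IsIrreducible →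
    Nonempty ((Matrix.ProjGenLinGroup.mk.comp ρ.toMonoidHom).range ≃* alternatingGroup (Fin 5)) →
    ∃ S : Finset ℕ, 2 ∈ S ∧ (∀ ℓ ∈ S, ℓ.Prime) ∧ ∃ σ₀ : FramedGaloisRep ℚ (PadicAlgCl 2) 2,
      σ₀.toMonoidHom = (Matrix.GeneralLinearGroup.map ι.symm.toRingHom).comp ρ.toMonoidHom ∧
      ∃ (hcpt : isCompact_glFiniteIntegralLevel 2 ℚ) (π : CuspidalAutomorphicRepData 2 ℚ hcpt),
        π.1.IsRegularAlgebraic ∧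
        ∀ v : HeightOneSpectrum (𝓞 ℚ), (∀ ℓ ∈ S, ((ℓ : ℕ) : 𝓞 ℚ) ∉ v.asIdeal) →
          ∃ (α : Multiset ℂ) (a b : PadicAlgCl 2), ‖a‖ ≤ 1 ∧ ‖b‖ ≤ 1 ∧
            π.1.HasSatakeParamAt v α ∧ σ₀.IsUnramifiedAt v ∧
            σ₀.HasFrobCharpolyAt v ((X - C a) * (X - C b)) ∧
            ∀ i : ℕ, ‖((X - C a) * (X - C b)).coeff i -
              (arithFrobPolyOfSatake ι v.residueCard 2 α).coeff i‖ < 1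

/-- Engine #1 (baseline, LANDED): Khare–Wintenberger at `p = 2` proves the interface — this is the
accepted `Sketch.stub_qLevel` of the predecessor crux E1′, nothing new. -/
theorem qLevelPackage_of_khareWintenberger
    (hKW : ∀ (p : ℕ) [Fact p.Prime] (k : Type) [Field k] [TopologicalSpace k] [DiscreteTopology k],
      khare_wintenberger p k) :
    QLevelPackage :=
  fun ι ρ hirr hA5 =>
    Summit.Langlands.Langlands.Cruxes.ResidualBianchiDoorLevel.Sketch.stub_qLevel hKW ι ρ hirr hA5

/-- **Transfer stub** (mechanical, difficulty M): the crux from the interface.  Proof = the body of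
`Theorems.ParityBlindBianchi.ResidualBianchiDoorLevelR_of_facts` (p125055) with `stub_bcTransfer`'s
three base-change facts read off clauses (a), (c), (d) of the hypothesis `QuadraticBaseChangeGL2`
(grounder g63-0's `stub_bcTransfer_quadratic`, evidence cand_16853, lean check rc 0). -/
theorem residualBianchiDoorLevelBC_of_qLevelPackage (h : QLevelPackage) :
    Summit.Langlands.Langlands.Theses.ParityBlindBianchi.ResidualBianchiDoorLevelBC := by
  sorry

/-- A *golden surface*: an abelian surface over `ℚ` with an endomorphism `φ` defined over `ℚ`
satisfying `φ² = φ + 1`, i.e. real multiplication by `ℤ[(1+√5)/2]` (the RM field of the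
Clebsch–Hirzebruch level-2 Hilbert modular surface). -/
def IsGoldenSurface (A : AbelianVariety ℚ) : Prop :=
  A.dim = 2 ∧ ∃ φ : A ⟶ A, φ ≫ φ = φ + 𝟙 A

/-- Framing convention of the tree (route AbelianSurfaceSerre): `r` is the matrix-valued
contragredient of the rational `p`-adic Tate module of `A` in the basis `b` (so that
`r.HasFrobCharpolyAt v Q` is the characteristic polynomial of ARITHMETIC Frobenius on `H¹`). -/
def IsTateFraming (A : AbelianVariety ℚ) (p : ℕ) [Fact p.Prime]
    (b : Module.Basis (Fin 4) ℚ_[p] (A.rationalTateModule p))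
    (r : FramedGaloisRep ℚ (PadicAlgCl p) 4) : Prop :=
  ∀ g : Field.absoluteGaloisGroup ℚ,
    (r g).val = ((LinearMap.toMatrix b b (A.rationalTateRep p g⁻¹)).map
      (algebraMap ℚ_[p] (PadicAlgCl p))).transpose

/-- `s` is a 2-dimensional PIECE of the `p`-adic cohomology of `A`: at almost every place both are
unramified and the Frobenius polynomial of `s` divides that of `A` (for a golden surface and `p`
inert in `ℚ(√5)`, e.g. `p = 2`, these are the two Galois-conjugate `λ`-adic halves). -/
def IsTatePiece (A : AbelianVariety ℚ) (p : ℕ) [Fact p.Prime]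
    (s : FramedGaloisRep ℚ (PadicAlgCl p) 2) : Prop :=
  ∃ (b : Module.Basis (Fin 4) ℚ_[p] (A.rationalTateModule p)) (r : FramedGaloisRep ℚ (PadicAlgCl p) 4),
    IsTateFraming A p b r ∧
    ∀ᶠ v : HeightOneSpectrum (𝓞 ℚ) in Filter.cofinite, ∃ (Ps Q : Polynomial (PadicAlgCl p)),
      s.IsUnramifiedAt v ∧ r.IsUnramifiedAt v ∧ s.HasFrobCharpolyAt v Ps ∧
      r.HasFrobCharpolyAt v Q ∧ Ps ∣ Q

/-- **K2 — golden surfaces are GL₂-modular (weight-two type).**  Every 2-dimensional piece of the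
`p`-adic cohomology of a golden surface over `ℚ` is the Galois shadow of a regular algebraic cuspidal
`π` on `GL₂(𝔸_ℚ)` (HLTT normalisation `m = 2`, arithmetic Frobenius).  TRUE in print via Ribet +
Khare–Wintenberger; the point of the card is the KW-FREE proof for surfaces with surjective mod-√5
representation: `A[√5] ≅ E[5]` for an elliptic curve `E/ℚ` (Shepherd-Barron–Taylor: the twist of
`X(5) ≅ ℙ¹` by a cyclotomic-determinant `GL₂(𝔽₅)`-module is `ℙ¹` over `ℚ`), `E` modular (BCDT 2001),
then modularity lifting at the ODD prime 5 (Kisin 2009: potentially Barsotti–Tate / potentially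
semistable of weight 2 over `ℚ`). -/
def GoldenPieceAutomorphic : Prop :=
  ∀ (A : AbelianVariety ℚ), IsGoldenSurface A →
    ∀ (p : ℕ) [Fact p.Prime] (ι : PadicAlgCl p ≃+* ℂ) (s : FramedGaloisRep ℚ (PadicAlgCl p) 2),
      IsTatePiece A p s → s.toGaloisRep.IsIrreducible →
      ∃ (hcpt : isCompact_glFiniteIntegralLevel 2 ℚ) (π : CuspidalAutomorphicRepData 2 ℚ hcpt),
        π.1.IsRegularAlgebraic ∧
        ∀ᶠ v : HeightOneSpectrum (𝓞 ℚ) in Filter.cofinite, ∃ α : Multiset ℂ,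
          π.1.HasSatakeParamAt v α ∧ s.IsUnramifiedAt v ∧
          s.HasFrobCharpolyAt v (arithFrobPolyOfSatake ι v.residueCard 2 α)

/-- **K1 — Shepherd-Barron–Taylor's golden realisation, at the level of Frobenius polynomials.**
For `ι : ℚ̄₂ ≃ ℂ` and an irreducible icosahedral Artin `ρ`, the 2-adic model `σ₀ = GL₂(ι⁻¹) ∘ ρ` is,
after a twist by a finite-order character `χ` (the unique odd-order square root of `det σ̄₀`, so that
`σ̄₀ ⊗ χ̄` lands in `SL₂(𝔽₄) ≅ A₅`), congruent modulo `𝔪_{ℤ̄₂}` at every place off a finite `S` to an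
irreducible 2-dimensional piece `s` of the 2-adic cohomology of a golden surface `A/ℚ`
(`A[2] ≅ σ̄₀ ⊗ χ̄` as `𝔽₄[Γ_ℚ]`-modules: SBT 1997 main theorem = BDSBT 2001 Thm 1.1 (1)(2)(4), from
the RATIONALITY over `ℚ` of the twisted level-2 Hilbert modular surface of `ℚ(√5)`
(Clebsch diagonal cubic with its `A₅`-action) and Ekedahl's Hilbert irreducibility). -/
def SBTGoldenRealisation : Prop :=
  ∀ (ι : PadicAlgCl 2 ≃+* ℂ) (ρ : FramedGaloisRep ℚ ℂ 2), ρ.toGaloisRep.IsIrreducible →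
    Nonempty ((Matrix.ProjGenLinGroup.mk.comp ρ.toMonoidHom).range ≃* alternatingGroup (Fin 5)) →
    ∃ (σ₀ : FramedGaloisRep ℚ (PadicAlgCl 2) 2) (A : AbelianVariety ℚ)
      (s : FramedGaloisRep ℚ (PadicAlgCl 2) 2) (χ : FramedGaloisRep ℚ (PadicAlgCl 2) 1) (S : Finset ℕ),
      σ₀.toMonoidHom = (Matrix.GeneralLinearGroup.map ι.symm.toRingHom).comp ρ.toMonoidHom ∧
      IsGoldenSurface A ∧ IsTatePiece A 2 s ∧ s.toGaloisRep.IsIrreducible ∧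
      Finite χ.toMonoidHom.range ∧
      ∀ v : HeightOneSpectrum (𝓞 ℚ), (∀ ℓ ∈ S, ((ℓ : ℕ) : 𝓞 ℚ) ∉ v.asIdeal) →
        ∃ (a b c e f : PadicAlgCl 2), ‖a‖ ≤ 1 ∧ ‖b‖ ≤ 1 ∧ ‖c‖ ≤ 1 ∧ ‖e‖ ≤ 1 ∧ ‖f‖ ≤ 1 ∧
          σ₀.IsUnramifiedAt v ∧ σ₀.HasFrobCharpolyAt v ((X - C a) * (X - C b)) ∧
          χ.IsUnramifiedAt v ∧ χ.HasFrobCharpolyAt v (X - C c) ∧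
          s.IsUnramifiedAt v ∧ s.HasFrobCharpolyAt v ((X - C e) * (X - C f)) ∧
          ‖(e + f) - c * (a + b)‖ < 1 ∧ ‖e * f - c ^ 2 * (a * b)‖ < 1

/-- **Engine #2 (this card): the interface from K1 + K2** — bookkeeping stub (difficulty M): apply
K2 to the piece `s` of K1 at `p = 2`, untwist the resulting `π` by the finite-order Hecke character
of `χ` (tree: `AutomorphicTwistBJ`, regular algebraicity preserved: `AlgebraicityTwist`), throw the
finitely many exceptional places of K2's `∀ᶠ` and the ramification of `χ` into `S` (allowed: `S` is
chosen after `ρ`, `ι`), keep `S` a set of primes containing `2`, and pass the congruence through the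
twist (`‖·‖` ultrametric on `ℤ̄₂`). -/
theorem qLevelPackage_of_golden (h1 : SBTGoldenRealisation) (h2 : GoldenPieceAutomorphic) :
    QLevelPackage := by
  sorry

/-- The whole line, kernel-composed from the two stubs above (no new sorry). -/
theorem residualBianchiDoorLevelBC_of_golden (h1 : SBTGoldenRealisation)
    (h2 : GoldenPieceAutomorphic) :
    Summit.Langlands.Langlands.Theses.ParityBlindBianchi.ResidualBianchiDoorLevelBC :=
  residualBianchiDoorLevelBC_of_qLevelPackage (qLevelPackage_of_golden h1 h2)

end Summit.Langlands.Langlands.Cruxes.ResidualBianchiDoorLevelBC.GoldenSurfaceTwoTorsion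

end
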